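import Summits.PneNP.PneNP.Theses.UncheckableSAT

/-!
# Route UncheckableSAT — `SumcheckRigidity` (stmt-PneNP-2303)

Rigidity of the tree's integer sumcheck: if a prover strategy `S` (challenge prefix ↦ next univariate polynomial of degree
`≤ size φ`) passes `Sumcheck.Accepts` with the TRUE claim `H(φ, [])` for EVERY challenge vector from `R^n`, `|R| > size φ`,
then `S` is the honest `Sumcheck.h` on every proper prefix from `R`.

Proof. Two polynomials of degree `≤ size φ < |R|` that differ, differ somewhere on `R` (root counting,
`card_filter_isRoot_le`). If `S r ≠ h r` pick `a ∈ R` with `S r (a) ≠ h r (a) = H(r ++ [a])`: the claim carried into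
the prefix `r ++ [a]` is wrong. A wrong carried claim propagates (descending induction on the number of remaining
rounds): the consistency check forces `S q (0) + S q (1)` to equal the wrong claim while `h q (0) + h q (1) = H(q)`, so
`S q ≠ h q` and some `a' ∈ R` carries a wrong claim one level down; at full length the final check `= P_φ(r) = H(r)` fails.
-/

set_option linter.dupNamespace false -- `Summit.PneNP.PneNP.…`: summit = sub-problem name (D-0017 single-conjunct layout)

namespace Summit.PneNP.PneNP.Theorems

open Finset Polynomial
open Literature.Computability.Complexity Literature.Computability.Complexity.Sumcheck

/-- **Support item `SumcheckRigidity` of route UncheckableSAT (stmt-PneNP-2303)**: a bounded-degree prover strategy accepted on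
every challenge vector from a set larger than the degree bound coincides with the honest sumcheck prover on every
proper prefix. [cite: AroraBarakCC2009, Thm. 8.21 (proof of the Claim)] [cite: LundEtAl1992, §3] -/
theorem uncheckableSAT_sumcheckRigidity_proof : Summit.PneNP.PneNP.Theses.UncheckableSAT.SumcheckRigidity := by
  unfold Summit.PneNP.PneNP.Theses.UncheckableSAT.SumcheckRigidity
  intro φ R S hR hdeg hA r hr hrR
  -- a fixed challenge for padding
  obtain ⟨a₀, ha₀⟩ : R.Nonempty := Finset.card_pos.1 (by omega)
  -- reading the middle element
  have getD_mid : ∀ (p l : List ℤ) (a : ℤ), (p ++ a :: l).getD p.length 0 = a := by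
    intro p l a
    induction p with
    | nil => simp
    | cons x p _ => simp
  -- two bounded-degree polynomials that differ, differ on `R`
  have hsep : ∀ P Q : ℤ[X], P.natDegree ≤ φ.size → Q.natDegree ≤ φ.size → P ≠ Q → ∃ a ∈ R, P.eval a ≠ Q.eval a := by
    intro P Q hP hQ hne
    by_contra hall
    push Not at hall
    have hsub : P - Q ≠ 0 := sub_ne_zero.2 hne
    have hroots : R.filter (fun a => (P - Q).IsRoot a) = R := by
      refine Finset.filter_true_of_mem fun a ha => ?_
      rw [IsRoot, eval_sub, hall a ha, sub_self]
    have h1 := card_filter_isRoot_le hsub R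
    rw [hroots] at h1
    have h2 : (P - Q).natDegree ≤ φ.size := (natDegree_sub_le P Q).trans (max_le hP hQ)
    omega
  -- a wrong carried claim propagates to a rejection
  have hD : ∀ (k : ℕ) (p : List ℤ) (a : ℤ), p.length + 1 + k = (varList φ).length → (∀ x ∈ p, x ∈ R) → a ∈ R →
      (S p).eval a ≠ H φ (varList φ) (p ++ [a]) → False := by
    intro k
    induction k with
    | zero =>
      intro p a hlen hp ha hbad
      have hfull : (p ++ [a]).length = (varList φ).length := by simp; omega
      have hmem : ∀ x ∈ p ++ [a], x ∈ R := by
        intro x hx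
        rw [List.mem_append, List.mem_singleton] at hx
        rcases hx with hx | rfl
        · exact hp x hx
        · exact ha
      have hacc := (hA (p ++ [a]) hfull hmem).2
      rw [← hfull] at hacc
      simp only [List.length_append, List.length_singleton, chain_succ] at hacc
      rw [List.take_left' rfl, getD_mid p [] a, ← H_full φ (varList φ) (p ++ [a]) hfull] at hacc
      exact hbad hacc
    | succ k ih =>
      intro p a hlen hp ha hbad
      have hr'len : (p ++ [a]).length = p.length + 1 := by simp
      have hlt : (p ++ [a]).length < (varList φ).length := by omega
      have hmem' : ∀ x ∈ p ++ [a], x ∈ R := by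
        intro x hx
        rw [List.mem_append, List.mem_singleton] at hx
        rcases hx with hx | rfl
        · exact hp x hx
        · exact ha
      have hrflen : (p ++ [a] ++ List.replicate (k + 1) a₀).length = (varList φ).length := by
        simp; omega
      have hrfmem : ∀ x ∈ p ++ [a] ++ List.replicate (k + 1) a₀, x ∈ R := by
        intro x hx
        rw [List.mem_append] at hx
        rcases hx with hx | hx
        · exact hmem' x hx
        · rw [List.mem_replicate] at hx
          rw [hx.2]
          exact ha₀
      have hcons := (hA _ hrflen hrfmem).1 (p ++ [a]).length hlt
      beta_reduce at hcons
      rw [List.take_left' rfl] at hcons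
      simp only [hr'len, chain_succ] at hcons
      have htake : (p ++ [a] ++ List.replicate (k + 1) a₀).take p.length = p := by
        rw [List.append_assoc]; exact List.take_left' rfl
      have hget : (p ++ [a] ++ List.replicate (k + 1) a₀).getD p.length 0 = a := by
        rw [List.append_assoc]; exact getD_mid p _ a
      rw [htake, hget] at hcons
      have hne : S (p ++ [a]) ≠ h φ (varList φ) (p ++ [a]) := by
        intro heq
        rw [heq, h_zero_add_h_one φ (varList φ) (p ++ [a]) hlt] at hcons
        exact hbad hcons.symm
      obtain ⟨a', ha', hne'⟩ := hsep _ _ (hdeg (p ++ [a])) (natDegree_h_le φ (varList φ) (p ++ [a])) hne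
      rw [eval_h] at hne'
      exact ih (p ++ [a]) a' (by omega) hmem' ha' hne'
  -- conclusion
  by_contra hne
  obtain ⟨a, ha, hne'⟩ := hsep _ _ (hdeg r) (natDegree_h_le φ (varList φ) r) hne
  rw [eval_h] at hne'
  exact hD ((varList φ).length - (r.length + 1)) r a (by omega) hrR ha hne'

end Summit.PneNP.PneNP.Theorems
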